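import Literature.AlgebraicGeometry.Resolution.HenselianConjugates
import Literature.AlgebraicGeometry.Resolution.Henselization
import Literature.AlgebraicGeometry.Resolution.Kuhlmann2019HenselianRationalityStepsProofs
import HarnessLib

/-!
# Krasner's lemma over a henselian subfield; separable limit points lie in the field

Topic: `Literature/AlgebraicGeometry/Resolution` (valued function fields). PROVED valuation
theory for the discharge of the hypothesis `(hKV)` of
`Kuhlmann2019_Prop52_sepClosed.of_degreeP_steps` (`Kuhlmann2019Prop52Reduction.lean`), i.e. of
F.-V. Kuhlmann, I. Vlahu, *The relative approximation degree in valued function fields*, Math.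
Z. 276 (2014) 203–235 = arXiv:1304.0200, **Thm. 11.1** as applied in the proof of F.-V.
Kuhlmann, *Elimination of ramification II*, Israel J. Math. 234 (2019), Prop. 5.2. The printed
proof of the degree bound behind Thm. 11.1 (Prop. 10.5, p. 21 of the arXiv version: "In view of
our separability condition, we can deduce by Krasner's Lemma (see [Eng–P], Theorem 4.1.7) that
`x ∈ K(y)^h(z)`") and Kuhlmann 2019, Thm. 2.3 ("a henselian field is separable-algebraically
closed in its completion (cf. [26, Theorem 32.19])") both rest on **Krasner's lemma over a
henselian valued field**, which this file proves in the ambient rendering of the tree (one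
algebraically closed valued field `(Ω, V)`, a subfield `L ≤ Ω` henselian for `V ∩ L`,
`IsHenselianField`, `Henselization.lean`):

* `krasner_of_isHenselianField` — **Krasner's lemma**: if `a ∈ Ω` is separable over `L` and
  `ℓ ∈ L` is closer to `a` than every other root of the minimal polynomial of `a` over `L`,
  then `a ∈ L`. Proof: an automorphism `σ` of `L^sep|L` preserves values (uniqueness of the
  extension of `V ∩ L`, `IsHenselianField.valuation_algEquiv_apply`), so
  `v(a - σa) = v((a - ℓ) - σ(a - ℓ)) ≥ v(a - ℓ)`, forcing `σa = a`; and `L^sep|L` is Galois.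
* `mem_of_isHenselianField_of_forall_exists_valuation_sub_lt` — **a separable-algebraic element
  in the closure of a henselian field lies in it** (the valuation-theoretic form of Kuhlmann
  2019, Thm. 2.3 / [26, Thm. 32.19]): if `a` is separable over `L` and approximable by elements
  of `L` to within every value of `L^×`, then `a ∈ L` (the other roots of the minimal polynomial
  are at positive distance, bounded below by a value of `L^×`, `exists_valuation_le_of_isAlgebraic`).

Everything is PROVED ([folklore]: Engler–Prestel, *Valued Fields*, Thm. 4.1.7; S. Warner,
*Topological fields*, Thm. 32.19); no definitions, no named facts.

## Sources

* F.-V. Kuhlmann, I. Vlahu, Math. Z. 276 (2014) = arXiv:1304.0200: Prop. 10.5, Thm. 11.1.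
* F.-V. Kuhlmann, Israel J. Math. 234 (2019) = arXiv:1701.05508: Thm. 2.3, Prop. 5.2.
  [Kuhlmann2019]
-/

noncomputable section

open IsLocalRing Polynomial

namespace Literature.AlgebraicGeometry.Resolution

universe u

variable {Ω : Type u} [Field Ω] [IsAlgClosed Ω] (V : ValuationSubring Ω)

/-- **Krasner's lemma over a henselian subfield.** Let `L ≤ Ω` be henselian for `V ∩ L`,
`a ∈ Ω` separable over `L`, and `ℓ ∈ L` with `v(a - ℓ) > v(a - a')` for every root `a' ≠ a` in
`Ω` of the minimal polynomial of `a` over `L`. Then `a ∈ L`. [folklore] -/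
theorem krasner_of_isHenselianField {L : Subfield Ω}
    (hL : IsHenselianField L (V.comap (algebraMap L Ω))) {a ℓ : Ω} (hℓ : ℓ ∈ L)
    (hsep : IsSeparable L a)
    (hclose : ∀ a' : Ω, a' ≠ a → aeval a' (minpoly L a) = 0 →
      V.valuation (a - ℓ) < V.valuation (a - a')) : a ∈ L := by
  classical
  let S : IntermediateField L Ω := separableClosure L Ω
  have haS : a ∈ S := mem_separableClosure_iff.mpr hsep
  have hℓS : ℓ ∈ S := S.algebraMap_mem ⟨ℓ, hℓ⟩
  -- it suffices that `a` is fixed by `Gal(L^sep|L)`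
  suffices hall : ∀ σ : S ≃ₐ[L] S, σ ⟨a, haS⟩ = ⟨a, haS⟩ by
    obtain ⟨y, hy⟩ := IntermediateField.mem_bot.mp
      ((InfiniteGalois.mem_bot_iff_fixed (k := L) (⟨a, haS⟩ : S)).mpr hall)
    have hya : ((y : L) : Ω) = a := congrArg (fun z : S => (z : Ω)) hy
    rw [← hya]
    exact y.2
  intro σ
  by_contra hne
  set OS : ValuationSubring S := V.comap (algebraMap S Ω) with hOS
  have hOSL : OS.comap (algebraMap L S) = V.comap (algebraMap L Ω) := by
    rw [hOS, ValuationSubring.comap_comap, ← IsScalarTower.algebraMap_eq]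
  -- `σ a ≠ a` is a root of the minimal polynomial of `a`
  have hne' : ((σ ⟨a, haS⟩ : S) : Ω) ≠ a := fun h => hne (Subtype.ext h)
  have hroot : aeval ((σ ⟨a, haS⟩ : S) : Ω) (minpoly L a) = 0 := by
    have hmin : minpoly L (⟨a, haS⟩ : S) = minpoly L a := by
      rw [← minpoly.algebraMap_eq (algebraMap S Ω).injective (⟨a, haS⟩ : S)]
      rfl
    have h1 : aeval (σ ⟨a, haS⟩) (minpoly L (⟨a, haS⟩ : S)) = 0 := by
      rw [show σ ⟨a, haS⟩ = (σ : S →ₐ[L] S) ⟨a, haS⟩ from rfl, aeval_algHom_apply,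
        minpoly.aeval, map_zero]
    rw [hmin] at h1
    have h2 := congrArg (algebraMap S Ω) h1
    rw [← aeval_algebraMap_apply, map_zero] at h2
    exact h2
  have hlt := hclose _ hne' hroot
  -- `σ` preserves values and fixes `ℓ`
  have hval : V.valuation ((σ (⟨a, haS⟩ - ⟨ℓ, hℓS⟩) : S) : Ω) = V.valuation (a - ℓ) := by
    have h := hL.valuation_algEquiv_apply OS hOSL σ (⟨a, haS⟩ - ⟨ℓ, hℓS⟩)
    exact (valuation_map_eq_iff (algebraMap S Ω) hOS.symm _ _).mpr h
  have hσℓ : σ ⟨ℓ, hℓS⟩ = ⟨ℓ, hℓS⟩ := σ.commutes ⟨ℓ, hℓ⟩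
  have hid : a - ((σ ⟨a, haS⟩ : S) : Ω) = (a - ℓ) - ((σ (⟨a, haS⟩ - ⟨ℓ, hℓS⟩) : S) : Ω) := by
    rw [map_sub, hσℓ]
    push_cast
    ring
  -- ultrametric contradiction
  have hle : V.valuation (a - ((σ ⟨a, haS⟩ : S) : Ω)) ≤ V.valuation (a - ℓ) := by
    rw [hid]
    refine le_trans (Valuation.map_sub _ _ _) ?_
    rw [hval, max_self]
  exact absurd hlt (not_lt.mpr hle)

/-- **A separable-algebraic element in the closure of a henselian subfield lies in it** (Kuhlmann
2019, Thm. 2.3: "a henselian field is separable-algebraically closed in its completion"). Let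
`L ≤ Ω` be henselian for `V ∩ L` and `a ∈ Ω` separable over `L` such that for every `e ∈ L^×`
there is `ℓ ∈ L` with `v(a - ℓ) < v(e)`. Then `a ∈ L`: the other roots `a'` of the minimal
polynomial of `a` are finitely many, each `a - a'` is a non-zero element algebraic over `L`, so
`v(a - a') ≥ v(e)` for some `e ∈ L^×`, and Krasner's lemma applies.
[cite: Kuhlmann2019, Thm. 2.3] -/
theorem mem_of_isHenselianField_of_forall_exists_valuation_sub_lt {L : Subfield Ω}
    (hL : IsHenselianField L (V.comap (algebraMap L Ω))) {a : Ω} (hsep : IsSeparable L a)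
    (happrox : ∀ e ∈ L, e ≠ 0 → ∃ ℓ ∈ L, V.valuation (a - ℓ) < V.valuation e) : a ∈ L := by
  classical
  have hint : IsIntegral L a := hsep.isIntegral
  -- the other roots of the minimal polynomial
  set R : Finset Ω := ((minpoly L a).aroots Ω).toFinset.erase a with hR
  have hRmem : ∀ a' : Ω, a' ≠ a → aeval a' (minpoly L a) = 0 → a' ∈ R := by
    intro a' hne h0
    rw [hR, Finset.mem_erase, Multiset.mem_toFinset, mem_aroots]
    exact ⟨hne, minpoly.ne_zero hint, h0⟩
  -- a common lower bound `e ∈ L^×` for the values `v(a - a')`, `a' ∈ R`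
  have hbound : ∃ e ∈ L, e ≠ 0 ∧ ∀ a' ∈ R, V.valuation e ≤ V.valuation (a - a') := by
    by_cases hRne : R.Nonempty
    · obtain ⟨b, hbR, hbmin⟩ := R.exists_min_image (fun a' => V.valuation (a - a')) hRne
      have hb : b ≠ a ∧ aeval b (minpoly L a) = 0 := by
        rw [hR, Finset.mem_erase, Multiset.mem_toFinset, mem_aroots] at hbR
        exact ⟨hbR.1, hbR.2.2⟩
      have hbint : IsIntegral L b := ⟨minpoly L a, minpoly.monic hint, hb.2⟩
      have halg : IsAlgebraic L (a - b) := (hint.sub hbint).isAlgebraic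
      have hab0 : a - b ≠ 0 := sub_ne_zero.mpr (Ne.symm hb.1)
      obtain ⟨e, heL, he0, he⟩ := exists_valuation_le_of_isAlgebraic V halg hab0
      exact ⟨e, heL, he0, fun a' ha' => le_trans he (hbmin a' ha')⟩
    · refine ⟨1, L.one_mem, one_ne_zero, fun a' ha' => ?_⟩
      exact absurd ⟨a', ha'⟩ hRne
  obtain ⟨e, heL, he0, he⟩ := hbound
  obtain ⟨ℓ, hℓL, hℓ⟩ := happrox e heL he0
  exact krasner_of_isHenselianField V hL hℓL hsep fun a' hne h0 =>
    lt_of_lt_of_le hℓ (he a' (hRmem a' hne h0))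

end Literature.AlgebraicGeometry.Resolution

end
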